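import Mathlib
import Literature.NumberTheory.Transcendental.KZCalculus
import Literature.NumberTheory.Transcendental.KZLogCalculusProofs
import Summits.KontsevichZagierPeriods.KontsevichZagierPeriods.Theorems.TorsionLogsNeronTorsionSectorStubHaarReps
import Summits.KontsevichZagierPeriods.KontsevichZagierPeriods.Theorems.TorsionLogsNeronTorsionSectorStubCellStepInst
import Summits.KontsevichZagierPeriods.KontsevichZagierPeriods.Theorems.TorsionLogsNeronTorsionSectorStubFoldStepInst
import Summits.KontsevichZagierPeriods.KontsevichZagierPeriods.Theorems.TorsionLogsNeronTorsionSectorStubLogStep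
import Summits.KontsevichZagierPeriods.KontsevichZagierPeriods.Theorems.TorsionLogsNeronTorsionSectorStubDlogUnfoldAux
import Summits.KontsevichZagierPeriods.KontsevichZagierPeriods.Theorems.TorsionLogsNeronTorsionSectorStubTranslationCalculus
import Summits.KontsevichZagierPeriods.KontsevichZagierPeriods.Theorems.TorsionLogsNeronTorsionSectorAssemblyRows
import Summits.KontsevichZagierPeriods.KontsevichZagierPeriods.Theorems.TorsionLogsNeronTorsionSectorAssemblyDecomp
import Summits.KontsevichZagierPeriods.KontsevichZagierPeriods.Theorems.TorsionLogsNeronTorsionSectorAssemblyObjects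
import Summits.KontsevichZagierPeriods.KontsevichZagierPeriods.Theorems.TorsionLogsNeronTorsionSectorAssemblyColumns
import Summits.KontsevichZagierPeriods.KontsevichZagierPeriods.Theorems.TorsionLogsNeronTorsionSectorAssemblyXSteps
import Summits.KontsevichZagierPeriods.KontsevichZagierPeriods.Theorems.TorsionLogsNeronTorsionSectorAssemblyLogClass
import Summits.KontsevichZagierPeriods.KontsevichZagierPeriods.Theorems.TorsionLogsNeronTorsionSectorStubCornerChartLower
import HarnessLib

/-!
# Crux `TorsionLogs.NeronTorsionSector` (stmt-KontsevichZagierPeriods-14500) — assembly, x-chart slice: the fold and the regular logs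

Helper for the lead's stub `stub_assembly` (line `registered`): on the interface representations, (i) the value of
the cocycle at the 2-torsion end, `q_m = Qf e₁ = Qf (x (m−1)) = q_{m−1}` (point symmetry, `stub_translationCalculus`);
(ii) the FOLD relation `c_{m−1} − 2t_{m−1} − ℓ(q_m) + θ_{m−1} ∈ relations` (`stub_foldStepInst` on the last row,
the square cell split into its two triangles, column shifts `asmCol_shift` from column 1 to the diagonal, row shifts of
the constants); (iii) the regular logs `θ_j − θ_1 ≡ Σ εᵢ[log carriers]` (`stub_logStep` on each cell, telescoped).
[cite: KontsevichZagier2001, §1.2]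
-/

noncomputable section

open Set MeasureTheory Filter Topology
open Literature.NumberTheory.Transcendental Literature.NumberTheory.Transcendental.KZ
open Literature.ModelTheory.ExponentialFields
open Summit.KontsevichZagierPeriods.HyperbolicBloch.OffTetraSectorKernel (isSemialgebraic_logIvl exists_logRep)

-- `Summit.KontsevichZagierPeriods.KontsevichZagierPeriods.…` is the tree's mandated layout (single-conjunct summit).
set_option linter.dupNamespace false

namespace Summit.KontsevichZagierPeriods.KontsevichZagierPeriods.Cruxes.NeronTorsionSector.Translation

/-- **x-chart slice, fold and regular logs** (see the module docstring). [cite: KontsevichZagier2001, §1.2] -/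
theorem asmX_fold :
    ∀ (g₂ g₃ e₁ L₁ : ℝ) (m : ℕ) (x y : ℕ → ℝ) (f yb sl τ Y3 Qf sl3 X33 Y33 Qf3 Pg G τ' : ℝ → ℝ),
    (∀ t, f t = 4 * t ^ 3 - g₂ * t - g₃) → f e₁ = 0 → 0 < e₁ → (∀ t, e₁ < t → 0 < f t) →
    6 ≤ m → x m = e₁ →
    (∀ k, 1 ≤ k → k < m → e₁ < x k ∧ y k < 0) → (∀ k, 1 ≤ k → k < m → x (k + 1) < x k) →
    (∀ k, 1 ≤ k → k ≤ m → IsAlgebraic ℚ (x k)) →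
    (∀ k, 1 ≤ k → k < m → IsAlgebraic ℚ (y k) ∧ y k ^ 2 = f (x k)) →
    IsAlgebraic ℚ g₂ → IsAlgebraic ℚ g₃ →
    L₁ = (12 * x 1 ^ 2 - g₂) / (2 * y 1) → x 2 = L₁ ^ 2 / 4 - 2 * x 1 → y 2 = -(y 1 + L₁ * (x 2 - x 1)) →
    yb = (fun t => -Real.sqrt (f t)) →
    sl = (fun t => (4 * t ^ 2 + 4 * t * x 1 + 4 * x 1 ^ 2 - g₂) / (yb t + y 1)) →
    τ = (fun t => sl t ^ 2 / 4 - t - x 1) →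
    Y3 = (fun t => -(yb t + sl t * (τ t - t))) →
    Qf = (fun t => sl t / 2 + Y3 t / (2 * τ t) - yb t / (2 * t)) →
    sl3 = (fun t => (4 * τ t ^ 2 + 4 * τ t * x 1 + 4 * x 1 ^ 2 - g₂) / (Y3 t + y 1)) →
    X33 = (fun t => sl3 t ^ 2 / 4 - τ t - x 1) →
    Y33 = (fun t => -(Y3 t + sl3 t * (X33 t - τ t))) →
    Qf3 = (fun t => sl3 t / 2 + Y33 t / (2 * X33 t) - Y3 t / (2 * τ t)) →
    Pg = (fun t => 4 * (t + 2 * x 1) * y 1 - L₁ * (4 * t ^ 2 + 4 * t * x 1 + 4 * x 1 ^ 2 - g₂)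
      + 4 * (t + 2 * x 1) * yb t) →
    G = (fun t => Pg t / (yb t + y 1) ^ 2 * Real.sqrt (t * X33 t) / τ t) →
    τ' = (fun t => Y3 t / yb t) →
    MeasureTheory.IntegrableOn (fun t => (Real.sqrt (f t))⁻¹) (Set.Ioi e₁) →
    StrictMonoOn τ (Set.Ici (x 1)) → τ '' Set.Ioi (x 1) = Set.Ioo (x 2) (x 1) →
    (∀ k, 1 ≤ k → k + 2 ≤ m → StrictMonoOn τ (Set.Icc (x (k + 1)) (x k)) ∧
      τ '' Set.Ioo (x (k + 1)) (x k) = Set.Ioo (x (k + 2)) (x (k + 1)) ∧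
      τ (x k) = x (k + 1) ∧ τ (x (k + 1)) = x (k + 2)) →
    StrictAntiOn τ (Set.Icc e₁ (x (m - 1))) → τ '' Set.Ioo e₁ (x (m - 1)) = Set.Ioo e₁ (x (m - 1)) →
    τ e₁ = x (m - 1) → τ (x (m - 1)) = e₁ →
    ∀ (Tx C1 : ℕ → Literature.NumberTheory.Transcendental.KZ.IntegralRep 2)
      (Θx : ℕ → Literature.NumberTheory.Transcendental.KZ.IntegralRep 1)
      (L1 : ℝ → Literature.NumberTheory.Transcendental.KZ.IntegralRep 1),
    (∀ j, 1 ≤ j → j < m → (Tx j).domain = {z | x (j + 1) < z 1 ∧ z 1 < z 0 ∧ z 0 < x j} ∧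
      Set.EqOn (Tx j).integrand (fun z => (g₂ * z 1 + 2 * g₃) / (4 * (z 1) ^ 2) / (Real.sqrt (f (z 0)) * Real.sqrt (f (z 1)))) (Tx j).domain) →
    (∀ j, 1 ≤ j → j < m → (C1 j).domain = {z | (x 2 < z 0 ∧ z 0 < x 1) ∧ x (j + 1) < z 1 ∧ z 1 < x j} ∧
      Set.EqOn (C1 j).integrand (fun z => (g₂ * z 1 + 2 * g₃) / (4 * (z 1) ^ 2) / (Real.sqrt (f (z 0)) * Real.sqrt (f (z 1)))) (C1 j).domain) →
    (∀ j, 1 ≤ j → j < m → (Θx j).domain = {t | x (j + 1) < t 0 ∧ t 0 < x j} ∧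
      Set.EqOn (Θx j).integrand (fun t => Qf (t 0) / Real.sqrt (f (t 0))) (Θx j).domain) →
    (∀ v, IsAlgebraic ℚ v → (L1 v).domain = {t | x 2 < t 0 ∧ t 0 < x 1} ∧
      Set.EqOn (L1 v).integrand (fun t => v / Real.sqrt (f (t 0))) (L1 v).domain) →
    Qf e₁ = Qf (x (m - 1)) ∧
    (Literature.NumberTheory.Transcendental.KZ.of (C1 (m - 1)) - 2 • Literature.NumberTheory.Transcendental.KZ.of (Tx (m - 1))
      - Literature.NumberTheory.Transcendental.KZ.of (L1 (Qf e₁)) + Literature.NumberTheory.Transcendental.KZ.of (Θx (m - 1)) ∈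
      Literature.NumberTheory.Transcendental.KZ.relations) ∧
    (∀ j, 1 ≤ j → j < m → ∃ (v : ℝ) (κ : ℕ) (α β : Fin κ → ℝ) (ε : Fin κ → ℤ)
      (cs : Fin κ → Literature.NumberTheory.Transcendental.KZ.IntegralRep 1),
      (∀ i, 0 < α i ∧ α i ≤ β i ∧ IsAlgebraic ℚ (α i) ∧ IsAlgebraic ℚ (β i) ∧
        (cs i).domain = {t | α i < t 0 ∧ t 0 < β i} ∧
        Set.EqOn (cs i).integrand (fun t => 1 / t 0) (cs i).domain) ∧
      ∑ i, (ε i : ℝ) * Real.log (β i / α i) = v ∧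
      (Literature.NumberTheory.Transcendental.KZ.of (Θx j) - Literature.NumberTheory.Transcendental.KZ.of (Θx 1))
        - ∑ i, ε i • Literature.NumberTheory.Transcendental.KZ.of (cs i) ∈ Literature.NumberTheory.Transcendental.KZ.relations) := by
  intro g₂ g₃ e₁ L₁ m x y f yb sl τ Y3 Qf sl3 X33 Y33 Qf3 Pg G τ' hf he₁ he₁pos hfpos hm6 hxm hgLow hgDec hgAlg'
    hgAlgy ag₂ ag₃ hL₁ hx2 hy2 hyb hsl hτ hY3 hQf hsl3 hX33 hY33 hQf3 hPg hG hτ' hInt hτmono0 hτimg0 hτcell hτfanti hτfimg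
    hτe₁ hτm1 Tx C1 Θx L1 hTx hC1 hΘx hL1
  have hx1 : e₁ < x 1 ∧ y 1 < 0 := hgLow 1 le_rfl (lt_of_lt_of_le (by norm_num) hm6)
  have h1m : 1 < m := lt_of_lt_of_le (by norm_num) hm6
  have h2m : 2 < m := lt_of_lt_of_le (by norm_num) hm6
  have h3m : 3 < m := lt_of_lt_of_le (by norm_num) hm6
  have hmm : m ≤ m := le_rfl
  have hm1 : m - 1 + 1 = m := Nat.sub_add_cancel h1m.le
  have hm1lt : m - 1 < m := Nat.sub_lt (Nat.zero_lt_of_lt h1m) Nat.one_pos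
  have h1m1 : 1 ≤ m - 1 := Nat.le_sub_one_of_lt h1m
  have hx1pos : 0 < x 1 := he₁pos.trans hx1.1
  have hx1alg : IsAlgebraic ℚ (x 1) := hgAlg' 1 le_rfl h1m.le
  have hy1 : IsAlgebraic ℚ (y 1) ∧ y 1 ^ 2 = f (x 1) := hgAlgy 1 le_rfl h1m
  have hx2low : e₁ < x 2 ∧ y 2 < 0 := hgLow 2 (by norm_num) h2m
  have hx2pos : 0 < x 2 := he₁pos.trans hx2low.1
  have hx2alg : IsAlgebraic ℚ (x 2) := hgAlg' 2 (by norm_num) h2m.le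
  have hx21 : x 2 < x 1 := hgDec 1 le_rfl h1m
  have he₁a : IsAlgebraic ℚ e₁ := by rw [← hxm]; exact hgAlg' m h1m.le hmm
  have hanti := asmDecomp_anti x m hgDec
  have hsanti := asmDecomp_strictAnti x m hgDec
  obtain ⟨-, hY3neg, hτc, hyby, hsemi, hrows, hfold⟩ := asmRows_package g₂ g₃ e₁ L₁ m x y f yb sl τ Y3 Qf sl3 X33 Y33 Qf3 Pg G
    τ' hf he₁ he₁pos hfpos hm6 hxm hgLow hgDec hgAlg' hy1.2 hy1.1 ag₂ ag₃ hL₁ hx2 hy2 hyb hsl hτ hY3 hQf hsl3 hX33 hY33 hQf3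
    hPg hG hτ' hτmono0 hτimg0 hτcell hτfanti hτfimg hτe₁ hτm1
  obtain ⟨-, -, -, hQfalg⟩ := asmX_steps g₂ g₃ e₁ L₁ m x y f yb sl τ Y3 Qf sl3 X33 Y33 Qf3 Pg G τ' hf he₁ he₁pos hfpos hm6 hxm
    hgLow hgDec hgAlg' hgAlgy ag₂ ag₃ hL₁ hx2 hy2 hyb hsl hτ hY3 hQf hsl3 hX33 hY33 hQf3 hPg hG hτ' hInt hτmono0 hτimg0 hτcell hτfanti
    hτfimg hτe₁ hτm1 Tx C1 Θx L1 hTx hC1 hΘx hL1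
  /- (i) the fold value -/
  have hQfe₁ : Qf e₁ = Qf (x (m - 1)) := by
    obtain ⟨honC, _, _, hsymm⟩ := stub_translationCalculus g₂ g₃ (x 1) (y 1) (-1) f yb sl τ Y3 Qf hf hy1.2 (Or.inr rfl)
      (by rw [hyb]; funext t; ring) hsl hτ hY3 hQf
    set t₀ := x (m - 1) with ht₀
    have ht₀e : e₁ < t₀ := (hgLow (m - 1) h1m1 hm1lt).1
    have hY30 : Y3 t₀ = 0 := by
      have := honC t₀ (hfpos _ ht₀e) (hyby t₀ ht₀e.le).ne
      rw [hτm1, he₁] at this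
      exact pow_eq_zero_iff two_ne_zero |>.mp this
    obtain ⟨hym1, hym1sq⟩ := hgAlgy (m - 1) h1m1 hm1lt
    have hybt₀ : yb t₀ = y (m - 1) := by
      simp only [hyb]; rw [← hym1sq, Real.sqrt_sq_eq_abs, abs_of_neg (hgLow (m - 1) h1m1 hm1lt).2, neg_neg]
    have hybe₁ : yb e₁ = 0 := by simp only [hyb]; rw [he₁, Real.sqrt_zero, neg_zero]
    have key := hsymm t₀ (yb t₀) (sl t₀) (τ t₀) (Y3 t₀) (sl e₁) (τ e₁) (Y3 e₁) (by rw [hybt₀]; exact hym1sq)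
      (hyby t₀ ht₀e.le).ne (he₁pos.trans ht₀e).ne' (by simp only [hsl]) (by simp only [hτ]) (by simp only [hY3])
      (by rw [hτm1]; exact he₁pos.ne') (by rw [hY30, neg_zero, zero_add]; exact hx1.2.ne)
      (by rw [hY30, hτm1, neg_zero]; simp only [hsl, hybe₁]) (by rw [hτm1]; simp only [hτ])
      (by rw [hY30, hτm1, neg_zero]; simp only [hY3, hybe₁])
    obtain ⟨_, _, hq⟩ := key
    have rhs : Qf t₀ = sl t₀ / 2 + Y3 t₀ / (2 * τ t₀) - yb t₀ / (2 * t₀) := by simp only [hQf]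
    rw [rhs, ← hq, hY30, neg_zero, zero_div, sub_zero]
    simp only [hQf]; rw [hybe₁]; ring
  have halgE : IsAlgebraic ℚ (Qf e₁) := by rw [hQfe₁]; exact hQfalg (m - 1) h1m1 hm1lt
  /- tools -/
  set Cb : ℝ := |g₂| / (4 * e₁) + |g₃| / (2 * e₁ ^ 2) with hCb
  have hCbd : ∀ t, e₁ < t → |(g₂ * t + 2 * g₃) / (4 * t ^ 2)| ≤ Cb := by
    intro t ht
    have ht0 : 0 < t := he₁pos.trans ht
    rw [abs_div, abs_of_pos (by positivity : (0:ℝ) < 4 * t ^ 2), hCb]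
    calc |g₂ * t + 2 * g₃| / (4 * t ^ 2) ≤ (|g₂| * t + 2 * |g₃|) / (4 * t ^ 2) := by
            gcongr
            calc |g₂ * t + 2 * g₃| ≤ |g₂ * t| + |2 * g₃| := abs_add_le _ _
              _ = |g₂| * t + 2 * |g₃| := by rw [abs_mul, abs_mul, abs_of_pos ht0, abs_two]
      _ = |g₂| / (4 * t) + |g₃| / (2 * t ^ 2) := by field_simp; ring
      _ ≤ |g₂| / (4 * e₁) + |g₃| / (2 * e₁ ^ 2) := by gcongr
  have hxk_gt : ∀ k, 1 ≤ k → k ≤ m → ∀ t, x k < t → e₁ < t := fun k hk hkm t ht =>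
    lt_of_le_of_lt (hxm.symm.le.trans (hanti k m hk hkm hmm)) ht
  have hrowσ : ∀ j, 1 ≤ j → j < m → IsSemialgebraic ℚ {p : Fin 1 → ℝ | p 0 ∈ Set.Ioo (x (j + 1)) (x j)} :=
    fun j hj hjm => isSemialgebraic_logIvl (hgAlg' (j + 1) (Nat.le_add_left 1 j) hjm) (hgAlg' j hj hjm.le)
  have hIccσ : ∀ j, 1 ≤ j → j < m → IsSemialgebraic ℚ {p : Fin 1 → ℝ | p 0 ∈ Set.Icc (x (j + 1)) (x j)} :=
    fun j hj hjm => cornerLower_isSemialgebraic_slab (hgAlg' (j + 1) (Nat.le_add_left 1 j) hjm) (hgAlg' j hj hjm.le)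
  have hIoiσ : IsSemialgebraic ℚ {p : Fin 1 → ℝ | p 0 ∈ Set.Ioi e₁} := isSemialgebraic_setOf_const_lt_apply he₁a 0
  have hkσ : IsSemialgebraicFunOn ℚ {p : Fin 1 → ℝ | p 0 ∈ Set.Ioi e₁} (fun p => (g₂ * p 0 + 2 * g₃) / (4 * p 0 ^ 2)) :=
    cellStep_isSemialgebraicFunOn_kernel hIoiσ ag₂ ag₃ fun p hp => (he₁pos.trans hp).ne'
  have hkc : ContinuousOn (fun t => (g₂ * t + 2 * g₃) / (4 * t ^ 2)) (Set.Ioi e₁) :=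
    ContinuousOn.div (by fun_prop) (by fun_prop) fun t ht => by have : 0 < t := he₁pos.trans ht; positivity
  have hplane : ∀ S : Set (Fin 2 → ℝ), IsSemialgebraic ℚ S → S ⊆ {z | e₁ < z 0 ∧ e₁ < z 1} →
      ∃ r : IntegralRep 2, r.domain = S ∧ Set.EqOn r.integrand (fun z => (g₂ * z 1 + 2 * g₃) / (4 * (z 1) ^ 2) / (Real.sqrt (f (z 0)) * Real.sqrt (f (z 1)))) r.domain := by
    intro S hS hSsub
    obtain ⟨r, hd, hi⟩ := stub_haarReps.2 g₂ g₃ e₁ Cb f (fun t => (g₂ * t + 2 * g₃) / (4 * t ^ 2)) (Set.Ioi e₁) S ag₂ ag₃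
      he₁a hf hfpos hInt subset_rfl hIoiσ hkσ hkc (fun t ht => hCbd t ht) hS (fun z hz => ⟨(hSsub hz).1, (hSsub hz).2⟩)
    exact ⟨r, hd, fun z _ => by rw [hi]⟩
  have hline : ∀ j, 1 ≤ j → j < m → ∀ g : ℝ → ℝ, ContinuousOn g (Set.Icc (x (j + 1)) (x j)) →
      IsSemialgebraicFunOn ℚ {p : Fin 1 → ℝ | p 0 ∈ Set.Ioo (x (j + 1)) (x j)} (fun p => g (p 0)) →
      ∃ r : IntegralRep 1, r.domain = {t | x (j + 1) < t 0 ∧ t 0 < x j} ∧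
        r.integrand = fun t => g (t 0) / Real.sqrt (f (t 0)) := by
    intro j hj hjm g hgc hgσ
    obtain ⟨M, hM⟩ := (isCompact_Icc.image_of_continuousOn hgc).isBounded.subset_closedBall_lt 0 0
    obtain ⟨r, hd, hi⟩ := stub_haarReps.1 g₂ g₃ e₁ M f g (Set.Ioo (x (j + 1)) (x j)) ag₂ ag₃ he₁a hf hfpos hInt
      (fun t ht => hxk_gt (j + 1) (Nat.le_add_left 1 j) hjm t ht.1) (hrowσ j hj hjm) hgσ (hgc.mono Ioo_subset_Icc_self)
      fun t ht => by
        have := hM.2 ⟨t, Ioo_subset_Icc_self ht, rfl⟩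
        rw [Metric.mem_closedBall, dist_zero_right, Real.norm_eq_abs] at this
        exact this
    exact ⟨r, hd, hi⟩
  have hsplit1 : ∀ (r r₁ r₂ : IntegralRep 1), r₁.domain = r.domain → r₂.domain = r.domain →
      Set.EqOn r.integrand (r₁.integrand + r₂.integrand) r.domain → of r - of r₁ - of r₂ ∈ relations :=
    fun r r₁ r₂ h1 h2 h3 => KZ.integrandAddRel_subset_relations ⟨1, r, r₁, r₂, h1, h2, h3, rfl⟩
  refine ⟨hQfe₁, ?_, ?_⟩
  · /- (ii) the fold -/
    obtain ⟨hstep, hQfc, hQfd⟩ := hfold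
    -- the last row in grid notation
    have hrowm : Set.Ioo (x (m - 1 + 1)) (x (m - 1)) = Set.Ioo e₁ (x (m - 1)) := by rw [hm1, hxm]
    -- `rOup = [(e₁, x (m−1)), (Qf e₁ − Qf)/√f]`, `Lrow j v = [row j, v/√f]`
    obtain ⟨rO, hOd, hOi⟩ := hline (m - 1) h1m1 hm1lt (fun t => Qf e₁ - Qf t)
      (by rw [hm1, hxm]; exact continuousOn_const.sub hQfc)
      (IsSemialgebraicFunOn.sub_holds (isSemialgebraicFunOn_const_of_isAlgebraic (hrowσ (m - 1) h1m1 hm1lt) halgE)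
        (hsemi _ (hrowσ (m - 1) h1m1 hm1lt)).2.1)
    have hLrow : ∀ j, ∃ r : IntegralRep 1, 1 ≤ j → j < m →
        r.domain = {t | x (j + 1) < t 0 ∧ t 0 < x j} ∧ r.integrand = fun t => Qf e₁ / Real.sqrt (f (t 0)) := by
      intro j
      by_cases h : 1 ≤ j ∧ j < m
      · obtain ⟨r, hd, hi⟩ := hline j h.1 h.2 (fun _ => Qf e₁) continuousOn_const
          (isSemialgebraicFunOn_const_of_isAlgebraic (hrowσ j h.1 h.2) halgE)
        exact ⟨r, fun _ _ => ⟨hd, hi⟩⟩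
      · exact ⟨rO, fun h1 h2 => absurd ⟨h1, h2⟩ h⟩
    choose Lrow hLrow using hLrow
    -- `Lrow (m−1) ≡ L1 (Qf e₁)` by row shifts
    have hLrow_shift : ∀ j, 1 ≤ j → j + 2 ≤ m → of (Lrow j) - of (Lrow (j + 1)) ∈ relations := by
      intro j hj hjm
      have hj1m : j + 1 < m := hjm
      obtain ⟨hd, hi⟩ := hLrow j hj (Nat.lt_of_succ_lt hj1m)
      obtain ⟨hd', hi'⟩ := hLrow (j + 1) (Nat.le_add_left 1 j) hj1m
      obtain ⟨-, hstep', -⟩ := hrows j hj hjm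
      obtain ⟨hmono, himg, -, -⟩ := hτcell j hj hjm
      refine of_sub_of_mem_relations_of_cov_fin_one (G := τ) (G' := τ') (I := Set.Ioo (x (j + 1)) (x j)) _ _
        (by rw [hd]; rfl) (by rw [hd]; exact (hsemi _ (hrowσ j hj (Nat.lt_of_succ_lt hj1m))).1) (fun t ht => (hstep' t ht).1)
        (hmono.injOn.mono Ioo_subset_Icc_self) (by rw [hd', himg]; rfl) fun t ht => ?_
      rw [hd] at ht
      obtain ⟨_, hhaar⟩ := hstep' (t 0) ht
      have hfτ : 0 < Real.sqrt (f (τ (t 0))) := by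
        have : τ (t 0) ∈ Set.Ioo (x (j + 2)) (x (j + 1)) := by rw [← himg]; exact ⟨t 0, ht, rfl⟩
        exact Real.sqrt_pos.2 (hfpos _ (hxk_gt (j + 2) (Nat.le_add_left 1 (j + 1)) hjm _ this.1))
      have hτ'0 : |τ' (t 0)| ≠ 0 := by
        intro h; rw [h, zero_mul] at hhaar; exact hfτ.ne' hhaar.symm
      rw [hi, hi']
      show Qf e₁ / Real.sqrt (f (t 0)) = Qf e₁ / Real.sqrt (f (τ (t 0))) * |τ' (t 0)|
      rw [← hhaar, div_mul_eq_mul_div, mul_comm (Qf e₁), mul_div_mul_left _ _ hτ'0]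
    have hLrow_toL1 : ∀ j, 1 ≤ j → j < m → of (Lrow j) - of (L1 (Qf e₁)) ∈ relations := by
      intro j hj hjm
      induction j, hj using Nat.le_induction with
      | base =>
        obtain ⟨hd, hi⟩ := hLrow 1 le_rfl h1m
        obtain ⟨hd', hi'⟩ := hL1 _ halgE
        refine KZ.of_sub_of_mem_relations_of_eqOn (by rw [hd', hd]) fun t ht => ?_
        rw [hi, hi' (by rw [hd', ← hd]; exact ht)]
      | succ k hk ih =>
        rw [← sub_sub_sub_cancel_left (of (L1 (Qf e₁))) (of (Lrow (k + 1))) (of (Lrow k))]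
        exact relations.sub_mem (ih (Nat.lt_of_succ_lt hjm)) (hLrow_shift k hk hjm)
    -- the square cell on the last row and its triangles
    have hSqsub : {z : Fin 2 → ℝ | (e₁ < z 0 ∧ z 0 < x (m - 1)) ∧ e₁ < z 1 ∧ z 1 < x (m - 1)} ⊆
        {z | e₁ < z 0 ∧ e₁ < z 1} := fun z hz => ⟨hz.1.1, hz.2.1⟩
    obtain ⟨Csq, hCsqd, hCsqi⟩ := hplane _ (asmObj_isSemialgebraic_rect he₁a (hgAlg' (m - 1) h1m1 hm1lt.le) he₁a
      (hgAlg' (m - 1) h1m1 hm1lt.le)) hSqsub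
    obtain ⟨Tl, Tt, hTld, hTli, hTtd, hTti, hSsplit⟩ := asmObj_square_split he₁a (hgAlg' (m - 1) h1m1 hm1lt.le) Csq hCsqd
    have hTl_Tx : of Tl - of (Tx (m - 1)) ∈ relations := by
      refine KZ.of_sub_of_mem_relations_of_eqOn (by rw [(hTx (m - 1) h1m1 hm1lt).1, hm1, hxm, hTld]) fun z hz => ?_
      rw [hTli, hCsqi (by rw [hCsqd]; rw [hTld] at hz; exact ⟨⟨hz.1.trans hz.2.1, hz.2.2⟩, hz.1, hz.2.1.trans hz.2.2⟩),
        (hTx (m - 1) h1m1 hm1lt).2 (by rw [(hTx (m - 1) h1m1 hm1lt).1, hm1, hxm]; rw [hTld] at hz; exact hz)]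
    -- the fold step
    have A : of Tt - of (Tx (m - 1)) - of rO ∈ relations :=
      stub_foldStepInst g₂ g₃ e₁ e₁ (x (m - 1)) Cb f τ τ' Qf (Tx (m - 1)) Tt rO hf ag₂ ag₃ he₁a (hgAlg' (m - 1) h1m1 hm1lt.le)
        he₁pos le_rfl (hgLow (m - 1) h1m1 hm1lt).1 hfpos hCbd (hInt.mono_set fun t ht => ht.1) hτfanti hτfimg hstep
        (hsemi _ (isSemialgebraic_logIvl he₁a (hgAlg' (m - 1) h1m1 hm1lt.le))).1
        (hsemi _ (cornerLower_isSemialgebraic_slab he₁a (hgAlg' (m - 1) h1m1 hm1lt.le))).2.1 hQfc hQfd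
        (by rw [(hTx (m - 1) h1m1 hm1lt).1, hm1, hxm])
        (fun z hz => (hTx (m - 1) h1m1 hm1lt).2 hz) hTtd
        (fun z hz => by rw [hTti, hCsqi (by rw [hCsqd]; rw [hTtd] at hz; exact ⟨⟨hz.1, hz.2.1.trans hz.2.2⟩, hz.1.trans hz.2.1, hz.2.2⟩)])
        (by rw [hOd, hm1, hxm]) (fun t _ => by rw [hOi])
    -- split of the output
    have B : of (Lrow (m - 1)) - of rO - of (Θx (m - 1)) ∈ relations := by
      obtain ⟨hLd, hLi⟩ := hLrow (m - 1) h1m1 hm1lt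
      obtain ⟨hΘd, hΘi⟩ := hΘx (m - 1) h1m1 hm1lt
      refine hsplit1 _ _ _ (by rw [hOd, hLd]) (by rw [hΘd, hLd]) fun t ht => ?_
      rw [Pi.add_apply, hLi, hOi, hΘi (by rw [hΘd, ← hLd]; exact ht)]; ring
    -- column reps over the last row and their shifts `C1 (m−1) ≡ Ccol 1 ≡ ⋯ ≡ Ccol (m−1) ≡ Csq`
    have hCcol : ∀ i, ∃ r : IntegralRep 2, 1 ≤ i → i < m →
        r.domain = {z | z 0 ∈ Set.Ioo (x (i + 1)) (x i) ∧ z 1 ∈ Set.Ioo e₁ (x (m - 1))} ∧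
        Set.EqOn r.integrand (fun z => (g₂ * z 1 + 2 * g₃) / (4 * (z 1) ^ 2) / (Real.sqrt (f (z 0)) * Real.sqrt (f (z 1)))) r.domain := by
      intro i
      by_cases h : 1 ≤ i ∧ i < m
      · obtain ⟨r, hd, hi⟩ := hplane {z | z 0 ∈ Set.Ioo (x (i + 1)) (x i) ∧ z 1 ∈ Set.Ioo e₁ (x (m - 1))}
          (((isSemialgebraic_setOf_const_lt_apply (n := 2) (hgAlg' (i + 1) (Nat.le_add_left 1 i) h.2) 0).inter
            (isSemialgebraic_setOf_apply_lt_const (n := 2) (hgAlg' i h.1 h.2.le) 0)).inter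
            ((isSemialgebraic_setOf_const_lt_apply (n := 2) he₁a 1).inter
              (isSemialgebraic_setOf_apply_lt_const (n := 2) (hgAlg' (m - 1) h1m1 hm1lt.le) 1)))
          fun z hz => ⟨hxk_gt (i + 1) (Nat.le_add_left 1 i) h.2 _ hz.1.1, hz.2.1⟩
        exact ⟨r, fun _ _ => ⟨hd, hi⟩⟩
      · exact ⟨Csq, fun h1 h2 => absurd ⟨h1, h2⟩ h⟩
    choose Ccol hCcol using hCcol
    have hshift : ∀ i, 1 ≤ i → i + 2 ≤ m → of (Ccol i) - of (Ccol (i + 1)) ∈ relations := by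
      intro i hi him
      have hi1m : i + 1 < m := him
      obtain ⟨hrange, hstep', -⟩ := hrows i hi him
      obtain ⟨hmono, himg, -, -⟩ := hτcell i hi him
      exact asmCol_shift g₂ g₃ f τ τ' (Set.Ioo (x (i + 1)) (x i)) (Set.Ioo (x (i + 2)) (x (i + 1))) (Set.Ioo e₁ (x (m - 1)))
        (Ccol i) (Ccol (i + 1)) (hrowσ i hi (Nat.lt_of_succ_lt hi1m)) (hsemi _ (hrowσ i hi (Nat.lt_of_succ_lt hi1m))).1
        (hmono.injOn.mono Ioo_subset_Icc_self) himg (fun t ht => ⟨(hstep' t ht).1, (hstep' t ht).2,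
          hfpos t (hrange t (Ioo_subset_Icc_self ht)).1, hfpos _ (by
            have : τ t ∈ Set.Ioo (x (i + 2)) (x (i + 1)) := by rw [← himg]; exact ⟨t, ht, rfl⟩
            exact hxk_gt (i + 2) (Nat.le_add_left 1 (i + 1)) him _ this.1)⟩)
        (hCcol i hi (Nat.lt_of_succ_lt hi1m)).1 (hCcol (i + 1) (Nat.le_add_left 1 i) hi1m).1
        (hCcol i hi (Nat.lt_of_succ_lt hi1m)).2 (hCcol (i + 1) (Nat.le_add_left 1 i) hi1m).2
    have hcol_to1 : ∀ i, 1 ≤ i → i < m → of (Ccol 1) - of (Ccol i) ∈ relations := by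
      intro i hi him
      induction i, hi using Nat.le_induction with
      | base => rw [sub_self]; exact relations.zero_mem
      | succ k hk ih =>
        rw [← sub_add_sub_cancel (of (Ccol 1)) (of (Ccol k)) (of (Ccol (k + 1)))]
        exact relations.add_mem (ih (Nat.lt_of_succ_lt him)) (hshift k hk him)
    have hC1_Ccol : of (C1 (m - 1)) - of (Ccol 1) ∈ relations := by
      obtain ⟨hd, hi⟩ := hC1 (m - 1) h1m1 hm1lt
      obtain ⟨hd', hi'⟩ := hCcol 1 le_rfl h1m
      have hdd : (Ccol 1).domain = (C1 (m - 1)).domain := by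
        rw [hd, hd', hm1, hxm]; rfl
      exact KZ.of_sub_of_mem_relations_of_eqOn hdd fun z hz => by rw [hi hz, hi' (by rw [hdd]; exact hz)]
    have hCcol_Csq : of (Ccol (m - 1)) - of Csq ∈ relations := by
      obtain ⟨hd, hi⟩ := hCcol (m - 1) h1m1 hm1lt
      have hdd : Csq.domain = (Ccol (m - 1)).domain := by rw [hCsqd, hd, hm1, hxm]; rfl
      exact KZ.of_sub_of_mem_relations_of_eqOn hdd fun z hz => by rw [hi hz, hCsqi (by rw [hdd]; exact hz)]
    rw [show of (C1 (m - 1)) - 2 • of (Tx (m - 1)) - of (L1 (Qf e₁)) + of (Θx (m - 1)) =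
      (of (C1 (m - 1)) - of (Ccol 1)) + (of (Ccol 1) - of (Ccol (m - 1))) + (of (Ccol (m - 1)) - of Csq)
      + (of Csq - of Tl - of Tt) + (of Tl - of (Tx (m - 1))) + (of Tt - of (Tx (m - 1)) - of rO)
      - (of (Lrow (m - 1)) - of rO - of (Θx (m - 1))) + (of (Lrow (m - 1)) - of (L1 (Qf e₁))) by rw [two_nsmul]; abel]
    exact relations.add_mem (relations.sub_mem (relations.add_mem (relations.add_mem (relations.add_mem (relations.add_mem
      (relations.add_mem hC1_Ccol (hcol_to1 (m - 1) h1m1 hm1lt)) hCcol_Csq) hSsplit) hTl_Tx) A) B)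
      (hLrow_toL1 (m - 1) h1m1 hm1lt)
  · /- (iii) the regular logs, telescoped -/
    have hlogStep : ∀ j, 1 ≤ j → j + 2 ≤ m → ∃ (κ : ℕ) (α β : Fin κ → ℝ) (ε : Fin κ → ℤ) (cs : Fin κ → IntegralRep 1),
        (∀ i, 0 < α i ∧ α i ≤ β i ∧ IsAlgebraic ℚ (α i) ∧ IsAlgebraic ℚ (β i) ∧
          (cs i).domain = {t | α i < t 0 ∧ t 0 < β i} ∧
          Set.EqOn (cs i).integrand (fun t => 1 / t 0) (cs i).domain) ∧
        ∑ i, (ε i : ℝ) * Real.log (β i / α i) = Real.log |G (x (j + 1))| - Real.log |G (x j)| ∧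
        of (Θx (j + 1)) - of (Θx j) - ∑ i, ε i • of (cs i) ∈ relations := by
      intro j hj hjm
      have hj1m : j + 1 < m := hjm
      have hjm' : j < m := Nat.lt_of_succ_lt hjm
      have h1j1 : 1 ≤ j + 1 := Nat.le_add_left 1 j
      have h1j2 : 1 ≤ j + 2 := Nat.le_add_left 1 (j + 1)
      have hae : e₁ ≤ x (j + 2) := hxm.symm.le.trans (hanti (j + 2) m h1j2 hjm hmm)
      obtain ⟨hmono, himg, -, -⟩ := hτcell j hj hjm
      obtain ⟨-, -, -, -, hGc, hGne, hGd⟩ := hrows j hj hjm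
      exact stub_logStep g₂ g₃ (x 1) (y 1) (x (j + 2)) (x (j + 1)) (x j) f yb sl τ Y3 Qf G (Θx j) (Θx (j + 1)) hf hy1.2 hx1.2
        ag₂ ag₃ hx1alg hy1.1 (hgAlg' (j + 2) h1j2 hjm) (hgAlg' (j + 1) h1j1 hj1m.le) (hgAlg' j hj hjm'.le)
        (he₁pos.trans_le hae) (hgDec (j + 1) h1j1 hj1m) (hgDec j hj hjm') (fun t ht => hfpos t (hae.trans_lt ht)) hyb hsl hτ
        hY3 hQf hmono himg hτc.continuousOn (hΘx j hj hjm').1 (hΘx j hj hjm').2 (hΘx (j + 1) h1j1 hj1m).1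
        (hΘx (j + 1) h1j1 hj1m).2 hGc hGne hGd (hsemi _ (hIccσ j hj hjm')).2.2.1
    intro j hj hjm
    induction j, hj using Nat.le_induction with
    | base => exact ⟨0, by simpa using logClass_zero⟩
    | succ k hk ih =>
      obtain ⟨v, hv⟩ := ih (Nat.lt_of_succ_lt hjm)
      have h := logClass_add (hlogStep k hk hjm) hv
      rw [sub_add_sub_cancel] at h
      exact ⟨_, h⟩

end Summit.KontsevichZagierPeriods.KontsevichZagierPeriods.Cruxes.NeronTorsionSector.Translation
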